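import Mathlib
import Summits.Ventures.DiscreteObjects.Mahler.CensusAuxCirclePoly
import Summits.Ventures.DiscreteObjects.Mahler.CensusAuxCheckLog

/-!
# Kernel checker for the one-variable circle claims, part A: primitives (venture `DiscreteObjects`, target L)

Cell `pub-namedobj`, seat `pub-namedobj-mahler-g15`. Framing: lottery ticket; floor = certified bounds/negative
ranges.

A COMPUTABLE checker, evaluated by `decide` with kernel reduction, for the statement `CircleClaim P gs m` of
`CensusAuxCirclePoly` (`-m ≤ P(w) - Σ_g f_g log G_g(w)` on `[-2, 2]` wherever all `G_g(w) > 0`; `P`, `G_g` rational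
coefficient lists, `f_g ≥ 0`), and its soundness `circleClaim_of_segCheck`.  A certificate is a list of CELLS
`(w₀, h, hints)` covering `[-2, 2]` (`coverFrom`); on a cell, with `δ = w - w₀`, `|δ| ≤ h`:

* `P(w₀ + δ)` is the exact Taylor shift (`taylorShift`, `qeval_taylorShift`);
* for each `g`: `G(w₀ + δ) = g₀ (1 + y(δ))` with `g₀ = G(w₀) > 0` and `y` an explicit polynomial with `y(0) = 0`;
  `log g₀ ≤ logUBh g₀ s` (`CensusAuxCheckLog.logUBAux` with the reduction exponent `s` supplied as a HINT — any `s` is sound);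
  `log(1 + y) ≤ y` always (`Real.log_le_sub_one_of_pos`), and when `Σ_i |y_i| h^i = η ≤ 1/2` the sharper
  `log(1 + y) ≤ y - y²/2 + η³/(1 - η)` (Mathlib `Real.abs_log_sub_add_sum_range_le`) with `y² ≥ y₁²δ² - 2|y₁| h τ`
  (`τ = h² Σ_{i≥2} |y_i| h^{i-2}` bounds `|y - y₁δ|`);
* the resulting polynomial lower bound `L(δ) + K` is minimised over `|δ| ≤ h` by `polyLB` (exact treatment of the
  quadratic part, absolute bound `absBound` for the tail).

Everything computed is in `ℚ`; every statement proved is over `ℝ`.  THIS FILE (part A): the rational primitives `qabs`,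
`qmax`, `taylorShift`, `absBound`, `quadPartLB`, `polyLB`, the hinted logarithm bound `logUBh` and the cubic logarithm
inequality `log_one_add_le_cubic`; part B (`CensusAuxCircleCheck`) assembles cells, segments and the soundness theorem.  No `native_decide`.
-/

namespace Summit.Ventures.DiscreteObjects.Mahler

/-! ## Small rational helpers (kept syntactically simple for kernel reduction) -/

/-- `|x|` on `ℚ` by a single comparison. -/
def qabs (x : ℚ) : ℚ := if x < 0 then -x else x

/-- `qabs = |·|`. -/
theorem qabs_eq_abs (x : ℚ) : qabs x = |x| := by
  unfold qabs; split_ifs with h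
  · rw [abs_of_neg h]
  · rw [abs_of_nonneg (not_lt.mp h)]

/-- `max` on `ℚ` by a single comparison. -/
def qmax (x y : ℚ) : ℚ := if x ≤ y then y else x

/-- `qmax = max`. -/
theorem qmax_eq_max (x y : ℚ) : qmax x y = max x y := by
  unfold qmax; split_ifs with h
  · rw [max_eq_right h]
  · rw [max_eq_left (not_le.mp h).le]

/-! ## Taylor shift and absolute bounds -/

/-- The coefficients of `p(w₀ + δ)` as a polynomial in `δ`. -/
def taylorShift (w0 : ℚ) : List ℚ → List ℚ
  | [] => []
  | c :: p => lAdd [c] (lAdd (lSMul w0 (taylorShift w0 p)) (0 :: taylorShift w0 p))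

/-- `qeval (taylorShift w₀ p) δ = qeval p (w₀ + δ)`. -/
theorem qeval_taylorShift {R : Type*} [Field R] [CharZero R] (w0 : ℚ) : ∀ (p : List ℚ) (δ : R),
    qeval (taylorShift w0 p) δ = qeval p ((w0 : R) + δ)
  | [], δ => by simp [taylorShift]
  | c :: p, δ => by
    rw [taylorShift, qeval_lAdd, qeval_lAdd, qeval_lSMul, qeval_cons, qeval_cons, qeval_cons, qeval_nil,
      qeval_taylorShift w0 p δ]
    ring

/-- `Σ_i |p_i| h^i`, an upper bound for `|p(δ)|` on `|δ| ≤ h`. -/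
def absBound : List ℚ → ℚ → ℚ
  | [], _ => 0
  | c :: p, h => qabs c + h * absBound p h

/-- `absBound` is nonnegative for `h ≥ 0`. -/
theorem absBound_nonneg : ∀ (p : List ℚ) {h : ℚ}, 0 ≤ h → 0 ≤ absBound p h
  | [], _, _ => le_rfl
  | c :: p, h, hh => by
    rw [absBound, qabs_eq_abs]; exact add_nonneg (abs_nonneg _) (mul_nonneg hh (absBound_nonneg p hh))

/-- `|p(δ)| ≤ absBound p h` for `|δ| ≤ h`. -/
theorem abs_qeval_le_absBound : ∀ (p : List ℚ) {h : ℚ} {δ : ℝ}, |δ| ≤ (h : ℝ) → |qeval p δ| ≤ (absBound p h : ℝ)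
  | [], _, _, _ => by simp [absBound]
  | c :: p, h, δ, hδ => by
    rw [absBound, qeval_cons, qabs_eq_abs]
    push_cast
    have ih := abs_qeval_le_absBound p hδ
    have hh : (0 : ℝ) ≤ h := (abs_nonneg δ).trans hδ
    calc |(c : ℝ) + δ * qeval p δ| ≤ |(c : ℝ)| + |δ * qeval p δ| := abs_add_le _ _
      _ = |(c : ℝ)| + |δ| * |qeval p δ| := by rw [abs_mul]
      _ ≤ |(c : ℝ)| + (h : ℝ) * (absBound p h : ℝ) := by
        have := mul_le_mul hδ ih (abs_nonneg _) hh
        linarith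

/-! ## Lower bound of a polynomial on `|δ| ≤ h` -/

/-- Lower bound for `l₁ δ + l₂ δ²` on `|δ| ≤ h`. -/
def quadPartLB (l1 l2 h : ℚ) : ℚ :=
  if 0 < l2 then qmax (-(l1 ^ 2 / (4 * l2))) (-(qabs l1 * h)) else -(qabs l1 * h) + l2 * h ^ 2

/-- Soundness of `quadPartLB`. -/
theorem quadPartLB_le (l1 l2 h : ℚ) {δ : ℝ} (hδ : |δ| ≤ (h : ℝ)) :
    (quadPartLB l1 l2 h : ℝ) ≤ (l1 : ℝ) * δ + (l2 : ℝ) * δ ^ 2 := by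
  have hh : (0 : ℝ) ≤ h := (abs_nonneg δ).trans hδ
  have hlin : -((|l1| : ℚ) : ℝ) * h ≤ (l1 : ℝ) * δ := by
    have h1 : |(l1 : ℝ) * δ| ≤ (|l1| : ℝ) * h := by
      rw [abs_mul]; exact mul_le_mul_of_nonneg_left hδ (abs_nonneg _)
    have := (abs_le.mp h1).1
    push_cast; linarith
  have hδ2 : δ ^ 2 ≤ (h : ℝ) ^ 2 := by
    rw [← sq_abs]; exact pow_le_pow_left₀ (abs_nonneg δ) hδ 2
  unfold quadPartLB
  split_ifs with hl2
  · rw [qmax_eq_max, qabs_eq_abs]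
    push_cast
    apply max_le
    · have hl2' : (0 : ℝ) < l2 := by exact_mod_cast hl2
      have hsq : 0 ≤ (l2 : ℝ) * (δ + l1 / (2 * l2)) ^ 2 := mul_nonneg hl2'.le (sq_nonneg _)
      have hexp : (l2 : ℝ) * (δ + l1 / (2 * l2)) ^ 2 = l1 * δ + l2 * δ ^ 2 + l1 ^ 2 / (4 * l2) := by
        field_simp; ring
      linarith
    · have : 0 ≤ (l2 : ℝ) * δ ^ 2 := mul_nonneg (by exact_mod_cast hl2.le) (sq_nonneg δ)
      push_cast at hlin; linarith
  · rw [qabs_eq_abs]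
    push_cast
    have hl2' : (l2 : ℝ) ≤ 0 := by exact_mod_cast not_lt.mp hl2
    have : (l2 : ℝ) * h ^ 2 ≤ l2 * δ ^ 2 := mul_le_mul_of_nonpos_left hδ2 hl2'
    push_cast at hlin; linarith

/-- Lower bound for `L(δ)` on `|δ| ≤ h`: exact quadratic part, absolute bound for the tail `Σ_{i≥3}`. -/
def polyLB (L : List ℚ) (h : ℚ) : ℚ :=
  match L with
  | [] => 0
  | [l0] => l0
  | [l0, l1] => l0 - qabs l1 * h
  | l0 :: l1 :: l2 :: T => l0 + quadPartLB l1 l2 h - h ^ 3 * absBound T h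

/-- Soundness of `polyLB`. -/
theorem polyLB_le (L : List ℚ) (h : ℚ) {δ : ℝ} (hδ : |δ| ≤ (h : ℝ)) : (polyLB L h : ℝ) ≤ qeval L δ := by
  have hh : (0 : ℝ) ≤ h := (abs_nonneg δ).trans hδ
  match L with
  | [] => simp [polyLB]
  | [l0] => simp [polyLB]
  | [l0, l1] =>
    simp only [polyLB, qeval_cons, qeval_nil, mul_zero, add_zero, qabs_eq_abs]
    push_cast
    have h1 : |(l1 : ℝ) * δ| ≤ (|l1| : ℝ) * h := by
      rw [abs_mul]; exact mul_le_mul_of_nonneg_left hδ (abs_nonneg _)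
    have := (abs_le.mp h1).1
    nlinarith
  | l0 :: l1 :: l2 :: T =>
    simp only [polyLB, qeval_cons]
    push_cast
    have hq := quadPartLB_le l1 l2 h hδ
    have ht := abs_qeval_le_absBound T hδ
    have hδ3 : |δ| ^ 3 ≤ (h : ℝ) ^ 3 := pow_le_pow_left₀ (abs_nonneg δ) hδ 3
    have htail : -((h : ℝ) ^ 3 * (absBound T h : ℝ)) ≤ δ ^ 3 * qeval T δ := by
      have h1 : |δ ^ 3 * qeval T δ| ≤ (h : ℝ) ^ 3 * (absBound T h : ℝ) := by
        rw [abs_mul, abs_pow]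
        exact mul_le_mul hδ3 ht (abs_nonneg _) (pow_nonneg hh 3)
      exact (abs_le.mp h1).1
    have hexp : (l0 : ℝ) + δ * ((l1 : ℝ) + δ * ((l2 : ℝ) + δ * qeval T δ)) =
        l0 + (l1 * δ + l2 * δ ^ 2) + δ ^ 3 * qeval T δ := by ring
    rw [hexp]
    linarith

/-! ## Hinted logarithm upper bound -/

/-- Mantissa of `x` for the reduction exponent `s`: `x · (4/5)^s`. -/
def logMant (x : ℚ) (s : ℤ) : ℚ := if 0 ≤ s then x * (4 / 5) ^ s.toNat else x * (5 / 4) ^ (-s).toNat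

/-- `x = logMant x s · (5/4)^s`. -/
theorem logMant_spec (x : ℚ) (s : ℤ) : (x : ℝ) = (logMant x s : ℝ) * ((5 : ℝ) / 4) ^ s := by
  unfold logMant
  split_ifs with hs
  · obtain ⟨n, rfl⟩ := Int.eq_ofNat_of_zero_le hs
    rw [Int.toNat_natCast, zpow_natCast]
    push_cast
    rw [mul_assoc, ← mul_pow]; norm_num
  · push Not at hs
    obtain ⟨n, rfl⟩ := Int.exists_eq_neg_ofNat hs.le
    rw [neg_neg, Int.toNat_natCast, zpow_neg, zpow_natCast]
    push_cast
    rw [mul_assoc, ← inv_pow, ← mul_pow]; norm_num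

/-- `logMant` preserves positivity. -/
theorem logMant_pos {x : ℚ} (hx : 0 < x) (s : ℤ) : 0 < logMant x s := by
  unfold logMant; split_ifs <;> positivity

/-- **Hinted computable upper bound for `log`**: `logUBh x s = s·log(5/4)↑↓ + series(logMant x s - 1)`; sound for every
hint `s`, accurate when `logMant x s ∈ [1, 5/4)`. -/
def logUBh (x : ℚ) (s : ℤ) : ℚ := logUBAux (s, logMant x s)

/-- Soundness: `log x ≤ logUBh x s` for rational `x > 0` and any `s`. -/
theorem log_le_logUBh (x : ℚ) (hx : 0 < x) (s : ℤ) : Real.log (x : ℝ) ≤ (logUBh x s : ℝ) := by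
  unfold logUBh logUBAux
  have hm : 0 < logMant x s := logMant_pos hx s
  have hm' : (0 : ℝ) < logMant x s := by exact_mod_cast hm
  have hlog : Real.log (x : ℝ) = Real.log (logMant x s : ℝ) + (s : ℝ) * Real.log ((5 : ℝ) / 4) := by
    rw [logMant_spec x s, Real.log_mul hm'.ne' (zpow_pos (by norm_num) _).ne', Real.log_zpow]
  have hser : Real.log (logMant x s : ℝ) ≤ (logSeriesUB (logMant x s - 1) : ℝ) := by
    have := log_one_add_le_logSeriesUB (y := logMant x s - 1) (by push_cast; linarith)
    push_cast at this
    rwa [add_sub_cancel] at this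
  rw [hlog]
  simp only
  by_cases hs : 0 ≤ s
  · rw [if_pos hs]
    have hs' : (0 : ℝ) ≤ (s : ℝ) := by exact_mod_cast hs
    have := mul_le_mul_of_nonneg_left log_five_fourths_le hs'
    push_cast
    linarith
  · rw [if_neg hs]
    push Not at hs
    have hs' : (s : ℝ) ≤ 0 := by exact_mod_cast hs.le
    have := mul_le_mul_of_nonpos_left le_log_five_fourths hs'
    push_cast
    linarith

/-! ## The cubic logarithm inequality -/

/-- `log(1 + y) ≤ y - y²/2 + η³/(1 - η)` for `|y| ≤ η ≤ 1/2`. -/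
theorem log_one_add_le_cubic {y η : ℝ} (hy : |y| ≤ η) (hη : η ≤ 1 / 2) :
    Real.log (1 + y) ≤ y - y ^ 2 / 2 + η ^ 3 / (1 - η) := by
  have hη1 : η < 1 := by linarith
  have hyabs : |y| < 1 := lt_of_le_of_lt hy hη1
  have h := Real.abs_log_sub_add_sum_range_le (x := -y) (by rwa [abs_neg]) 2
  rw [abs_neg, sub_neg_eq_add] at h
  have hsum : ∑ i ∈ Finset.range 2, (-y) ^ (i + 1) / (i + 1) = -y + y ^ 2 / 2 := by
    simp only [Finset.sum_range_succ, Finset.sum_range_zero]; norm_num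
  rw [hsum] at h
  have h2 := (abs_le.mp h).2
  have hmono : |y| ^ 3 / (1 - |y|) ≤ η ^ 3 / (1 - η) := by
    have h1 : 0 < 1 - η := by linarith
    have h1' : 0 < 1 - |y| := by linarith
    rw [div_le_div_iff₀ h1' h1]
    have := pow_le_pow_left₀ (abs_nonneg y) hy 3
    have hy0 := abs_nonneg y
    nlinarith [pow_nonneg hy0 3]
  linarith

end Summit.Ventures.DiscreteObjects.Mahler
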